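import Literature.MathematicalPhysics.QuantumFieldTheory.Balaban1983to89.B7Eq31BCH

/-!
# `Balaban1983to89.B14ChangeOfVariables` — [Balaban1988Convergent] (1.22) p. 251 with the cut-off `g` of p. 252:
the nonlinear change of the fluctuation variables that localizes the characteristic functions

statement-level skeleton of published theorems with citation tags; proofs where landed; nothing here is a
claim about the Yang–Mills mass gap

CITATION HEADER (lean-in-tree rule).  Source: T. Bałaban, *Convergent renormalization expansions for lattice gauge
theories*, Commun. Math. Phys. **119**, 243–285 (1988), doi:10.1007/bf01217741 [Balaban1988Convergent] (cell paper
B14 = "[III]"; held `paper:balaban1988-cmp119-convergent-renormalization`, journal page = PDF page + 242; the displays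
were read on the x2 renders p009 (p. 251) and p010 (p. 252) of `run/shared/lean/pub/pub-balaban/b2b-balaban-ref1/
pages/1988-cmp119-convergent-renormalization/`).  The Baker–Campbell–Hausdorff remainder is B14's ref. "(29) in
[12]" = [Balaban1985Averaging] (29) p. 22 (cell paper B7), whose Banach-algebra form lives in the sibling modules
`MatrixLog` (`mlog`, the series (21)) and `B7Eq31BCH` ((31): `‖log eˣeʸ − X − Y‖ ≤ 2‖X‖‖Y‖`).  Mega-formalization
`lit-balaban`, unit `lit-balaban-r11` (CMP 119), SKELETON row B14.Eq1.22 (and the k-th step use p. 269, row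
B14.Eq3.21–3.22; cited downstream: [Balaban1989LargeFieldI] p. 188 "the change of variables (1.22) [III]").

THE PRINTED TEXT (verbatim).
* p. 251 [PDF 9]: *"Now we make a change of variables for each bond variable A(b), b ∈ S₁*. There are two forms of
  this change of variables. For b ∈ (R₁^{∼2}∩S₁)*, we take
  A(b) = (1/(ig₀)) log exp ig₀A′(b) exp(−ig(A′(b))𝐇_{1,Ax}(b))
       = A′(b) − (1/g₀) g(A′(b))𝐇_{1,Ax}(b) − (1/g₀) 𝐅(g₀A′(b), −g(A′(b))𝐇_{1,Ax}(b)). (1.22)"*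
* p. 252 [PDF 10]: *"Here g is a C^∞-function defined on the Lie algebra 𝐠, 0 ≤ g(A′) ≤ 1, g(A′) = 0 on
  {A′ ∈ 𝐠 : |A′| ≤ 4/3 g₀⁻¹δ₀}, g(A′) = 1 on {A′ ∈ 𝐠 : |exp ig₀A′ − 1| ≥ 5/3 δ₀}. … The function 𝐅 is defined as a
  sum of terms of orders higher than 1 in the Baker-Campbell-Haussdorf formula (see (29) in [12]). It is at least
  linear in g₀A′(b), hence the factor g₀⁻¹ is cancelled. In the second term on the right-hand side of (1.22) the
  factor g₀⁻¹ is suppressed by the bounds on 𝐇_{1,Ax}. … For b ∈ S₁*∖(R₁^{∼2})* we make a simpler change of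
  variables; we take (1.22) with the function g(A′(b)) replaced by 1."*

WHAT IS TYPED (one bond at a time, in a complete normed `ℂ`-algebra `𝔸` ⊇ 𝐠 — the setting of `MatrixLog`/`B7Eq31BCH`;
`log` = the series `MatrixLog.mlog`, `exp` = `NormedSpace.exp`).  `bF X Y` = Bałaban's 𝐅 with his factors of `i`
(so that `(1/i) log(e^{iX}e^{iY}) = X + Y − 𝐅(X, Y)`, the sign the display (1.22) prints); `IsCutoff g₀ δ₀ g` = the
four printed properties of `g`; `newVar g₀ g H A′` = the FIRST line of (1.22) (the definition of the new variable
`A(b)` from `A′(b)` and `H = 𝐇_{1,Ax}(b)`); `newVarSimple` = the version with `g ≡ 1`.  PROVED: `eq122` — the SECOND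
line of (1.22) is an identity following from the first (module algebra over `ℂ`, `g₀ ≠ 0`); `norm_bF_le` — 𝐅 is of
second order, `‖𝐅(X, Y)‖ ≤ 2‖X‖‖Y‖` on `‖X‖, ‖Y‖ ≤ 1/10` (from B7 (31)), whence `norm_inv_g0_bF_le`: the factor
`g₀⁻¹` in front of 𝐅(g₀A′, ·) IS cancelled (p. 252); `newVar_eq_self_of_cutoff_zero` — where `g(A′) = 0` (small
`A′`) the change of variables is the identity.  NOT typed: the smooth-manifold facts about `g` beyond the predicate,
the Jacobian (1.24), the bounds on 𝐇_{1,Ax} (B11 (190)).  No `sorry`, no axiom; nothing printed is asserted beyond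
these identities/inequalities.
-/

namespace Literature.MathematicalPhysics.QuantumFieldTheory.Balaban1983to89.B14.ChangeOfVariables

open NormedSpace
open Literature.MathematicalPhysics.QuantumFieldTheory.Balaban1983to89 MatrixLog
open scoped ContDiff

section Algebra

variable {𝔸 : Type*} [NormedRing 𝔸] [NormedAlgebra ℂ 𝔸]

/-- **𝐅 of (1.22)**: *"the sum of terms of orders higher than 1 in the Baker-Campbell-Haussdorf formula (see (29)
in [12])"*, in Bałaban's Hermitian convention `U = exp iA`: `𝐅(X, Y) := i·(log(e^{iX}e^{iY}) − iX − iY)`, so that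
`(1/i) log(e^{iX} e^{iY}) = X + Y − 𝐅(X, Y)` (`ilog_exp_mul_exp`). [cite: Balaban1988Convergent, (1.22) p.251-252] -/
noncomputable def bF (X Y : 𝔸) : 𝔸 :=
  (Complex.I : ℂ) • (mlog (exp ((Complex.I : ℂ) • X) * exp ((Complex.I : ℂ) • Y)) -
    (Complex.I : ℂ) • X - (Complex.I : ℂ) • Y)

/-- The defining identity of 𝐅 in the form used by (1.22): `(1/i) log(e^{iX} e^{iY}) = X + Y − 𝐅(X, Y)`.
[cite: Balaban1988Convergent, (1.22) p.251] -/
theorem ilog_exp_mul_exp (X Y : 𝔸) :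
    (Complex.I : ℂ)⁻¹ • mlog (exp ((Complex.I : ℂ) • X) * exp ((Complex.I : ℂ) • Y)) = X + Y - bF X Y := by
  unfold bF
  rw [Complex.inv_I]
  simp only [smul_sub, smul_smul, Complex.I_mul_I, one_smul, neg_smul]
  abel

/-- **p. 252**, the cut-off `g`: *"g is a C^∞-function defined on the Lie algebra 𝐠, 0 ≤ g(A′) ≤ 1, g(A′) = 0 on
{A′ ∈ 𝐠 : |A′| ≤ 4/3 g₀⁻¹δ₀}, g(A′) = 1 on {A′ ∈ 𝐠 : |exp ig₀A′ − 1| ≥ 5/3 δ₀}"* — typed as a predicate on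
`g : 𝔸 → ℝ` (smoothness over `ℝ`; `|·|` = the norm of `𝔸`). [cite: Balaban1988Convergent, p.252] -/
def IsCutoff (g₀ δ₀ : ℝ) (g : 𝔸 → ℝ) : Prop :=
  ContDiff ℝ ∞ g ∧ (∀ A : 𝔸, 0 ≤ g A ∧ g A ≤ 1) ∧
    (∀ A : 𝔸, ‖A‖ ≤ 4 / 3 * g₀⁻¹ * δ₀ → g A = 0) ∧
    (∀ A : 𝔸, 5 / 3 * δ₀ ≤ ‖exp (((Complex.I : ℂ) * (g₀ : ℂ)) • A) - 1‖ → g A = 1)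

/-- **(1.22) p. 251, first line** — the new variable on a bond `b ∈ (R₁^{∼2}∩S₁)*`:
`A(b) := (1/(ig₀)) log[exp(ig₀A′(b)) · exp(−i g(A′(b)) 𝐇_{1,Ax}(b))]` (`H` = the value `𝐇_{1,Ax}(b)`).
[cite: Balaban1988Convergent, (1.22) p.251] -/
noncomputable def newVar (g₀ : ℝ) (g : 𝔸 → ℝ) (H A' : 𝔸) : 𝔸 :=
  ((Complex.I : ℂ) * (g₀ : ℂ))⁻¹ •
    mlog (exp (((Complex.I : ℂ) * (g₀ : ℂ)) • A') * exp (-(((Complex.I : ℂ) * ((g A' : ℝ) : ℂ)) • H)))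

/-- p. 252: *"For b ∈ S₁*∖(R₁^{∼2})* we make a simpler change of variables; we take (1.22) with the function
g(A′(b)) replaced by 1."* [cite: Balaban1988Convergent, p.252] -/
noncomputable def newVarSimple (g₀ : ℝ) (H A' : 𝔸) : 𝔸 := newVar g₀ (fun _ => 1) H A'

/-- **(1.22) p. 251, second line**, PROVED from the first: for `g₀ ≠ 0`,
`A(b) = A′(b) − g₀⁻¹ g(A′(b)) H − g₀⁻¹ 𝐅(g₀A′(b), −g(A′(b)) H)`. [cite: Balaban1988Convergent, (1.22) p.251] -/
theorem eq122 {g₀ : ℝ} (hg0 : g₀ ≠ 0) (g : 𝔸 → ℝ) (H A' : 𝔸) :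
    newVar g₀ g H A' =
      A' - ((g₀ : ℂ)⁻¹ * ((g A' : ℝ) : ℂ)) • H - (g₀ : ℂ)⁻¹ • bF ((g₀ : ℂ) • A') (-(((g A' : ℝ) : ℂ) • H)) := by
  have hg0' : (g₀ : ℂ) ≠ 0 := by exact_mod_cast hg0
  unfold newVar bF
  -- align the arguments of `exp`
  have e1 : ((Complex.I : ℂ) * (g₀ : ℂ)) • A' = (Complex.I : ℂ) • ((g₀ : ℂ) • A') := by rw [smul_smul]
  have e2 : -(((Complex.I : ℂ) * ((g A' : ℝ) : ℂ)) • H) = (Complex.I : ℂ) • (-(((g A' : ℝ) : ℂ) • H)) := by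
    rw [smul_neg, smul_smul]
  rw [e1, e2]
  set M := mlog (exp ((Complex.I : ℂ) • ((g₀ : ℂ) • A')) * exp ((Complex.I : ℂ) • -(((g A' : ℝ) : ℂ) • H)))
  rw [mul_inv_rev, Complex.inv_I]
  simp only [smul_sub, smul_neg, smul_smul]
  have c1 : (g₀ : ℂ)⁻¹ * -Complex.I = -((g₀ : ℂ)⁻¹ * Complex.I) := mul_neg _ _
  have c2 : (g₀ : ℂ)⁻¹ * (Complex.I * (Complex.I * (g₀ : ℂ))) = -1 := by
    rw [← mul_assoc Complex.I, Complex.I_mul_I, neg_one_mul, mul_neg, inv_mul_cancel₀ hg0']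
  have c3 : (g₀ : ℂ)⁻¹ * (Complex.I * (Complex.I * ((g A' : ℝ) : ℂ))) = -((g₀ : ℂ)⁻¹ * ((g A' : ℝ) : ℂ)) := by
    rw [← mul_assoc Complex.I, Complex.I_mul_I, neg_one_mul, mul_neg]
  rw [c1, c2, c3]
  simp only [neg_smul, one_smul, neg_neg, sub_neg_eq_add]
  abel

/-- `‖iX‖ = ‖X‖`. [cite: Balaban1988Convergent, (1.22) p.251] -/
theorem norm_I_smul (X : 𝔸) : ‖(Complex.I : ℂ) • X‖ = ‖X‖ := by
  rw [norm_smul, Complex.norm_I, one_mul]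

/-- The `IsCutoff` clause that triggers `newVar_eq_self_of_cutoff_zero`: `g(A′) = 0` for `|A′| ≤ 4/3 g₀⁻¹δ₀`.
[cite: Balaban1988Convergent, p.252] -/
theorem IsCutoff.eq_zero {g₀ δ₀ : ℝ} {g : 𝔸 → ℝ} (hg : IsCutoff g₀ δ₀ g) {A : 𝔸}
    (hA : ‖A‖ ≤ 4 / 3 * g₀⁻¹ * δ₀) : g A = 0 :=
  hg.2.2.1 A hA

/-- The `IsCutoff` clause for large approximate fields: `g(A′) = 1` when `|exp ig₀A′ − 1| ≥ 5/3 δ₀` — there the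
full correction `−g₀⁻¹𝐇` acts. [cite: Balaban1988Convergent, p.252] -/
theorem IsCutoff.eq_one {g₀ δ₀ : ℝ} {g : 𝔸 → ℝ} (hg : IsCutoff g₀ δ₀ g) {A : 𝔸}
    (hA : 5 / 3 * δ₀ ≤ ‖exp (((Complex.I : ℂ) * (g₀ : ℂ)) • A) - 1‖) : g A = 1 :=
  hg.2.2.2 A hA

end Algebra

section Bounds

variable {𝔸 : Type*} [NormedRing 𝔸] [NormedAlgebra ℂ 𝔸] [CompleteSpace 𝔸]

/-- **p. 252: 𝐅 is of second order** (*"a sum of terms of orders higher than 1 in the Baker-Campbell-Haussdorf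
formula"*): `‖𝐅(X, Y)‖ ≤ 2‖X‖‖Y‖` for `‖X‖, ‖Y‖ ≤ 1/10` — [Balaban1985Averaging] (31) in the kernel form
`B7Eq31BCH.eq31_printed`, transported through the factors of `i`. [cite: Balaban1988Convergent, p.252] -/
theorem norm_bF_le {X Y : 𝔸} (hX : ‖X‖ ≤ 1 / 10) (hY : ‖Y‖ ≤ 1 / 10) : ‖bF X Y‖ ≤ 2 * ‖X‖ * ‖Y‖ := by
  unfold bF
  rw [norm_I_smul]
  have h := B7Eq31BCH.eq31_printed (X := (Complex.I : ℂ) • X) (Y := (Complex.I : ℂ) • Y)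
    (by rw [norm_I_smul]; exact hX) (by rw [norm_I_smul]; exact hY)
  rwa [norm_I_smul, norm_I_smul] at h

/-- **p. 252, verbatim: *"It is at least linear in g₀A′(b), hence the factor g₀⁻¹ is cancelled."***  For `g₀ > 0`,
`‖g₀A′‖ ≤ 1/10` and `‖Y‖ ≤ 1/10`: `‖g₀⁻¹ 𝐅(g₀A′, Y)‖ ≤ 2‖A′‖‖Y‖` — no inverse power of `g₀` survives.
[cite: Balaban1988Convergent, p.252, (1.22) p.251] -/
theorem norm_inv_g0_bF_le {g₀ : ℝ} (hg0 : 0 < g₀) {A' Y : 𝔸} (hA : ‖(g₀ : ℂ) • A'‖ ≤ 1 / 10)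
    (hY : ‖Y‖ ≤ 1 / 10) : ‖(g₀ : ℂ)⁻¹ • bF ((g₀ : ℂ) • A') Y‖ ≤ 2 * ‖A'‖ * ‖Y‖ := by
  have hn : ‖(g₀ : ℂ) • A'‖ = g₀ * ‖A'‖ := by
    rw [norm_smul, Complex.norm_real, Real.norm_of_nonneg hg0.le]
  have h := norm_bF_le hA hY
  rw [norm_smul, norm_inv, Complex.norm_real, Real.norm_of_nonneg hg0.le]
  rw [hn] at h
  calc g₀⁻¹ * ‖bF ((g₀ : ℂ) • A') Y‖ ≤ g₀⁻¹ * (2 * (g₀ * ‖A'‖) * ‖Y‖) :=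
        mul_le_mul_of_nonneg_left h (inv_nonneg.mpr hg0.le)
    _ = 2 * ‖A'‖ * ‖Y‖ := by field_simp

/-- Where the cut-off vanishes the change of variables is the identity: if `g(A′) = 0` (e.g. by `IsCutoff` on
`|A′| ≤ 4/3 g₀⁻¹δ₀`) and `‖ig₀A′‖ < ln 2` (so that `log e^{ig₀A′} = ig₀A′`, `B7BlockAvgLog.mlog_exp`), then
`A(b) = A′(b)`. [cite: Balaban1988Convergent, (1.22) p.251, p.252] -/
theorem newVar_eq_self_of_cutoff_zero {g₀ : ℝ} (hg0 : g₀ ≠ 0) {g : 𝔸 → ℝ} {H A' : 𝔸} (hgA : g A' = 0)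
    (hsmall : ‖((Complex.I : ℂ) * (g₀ : ℂ)) • A'‖ < Real.log 2) : newVar g₀ g H A' = A' := by
  have hg0' : (Complex.I : ℂ) * (g₀ : ℂ) ≠ 0 := mul_ne_zero Complex.I_ne_zero (by exact_mod_cast hg0)
  unfold newVar
  rw [hgA]
  simp only [Complex.ofReal_zero, mul_zero, zero_smul, neg_zero, exp_zero, mul_one]
  rw [B7BlockAvgLog.mlog_exp hsmall, smul_smul, inv_mul_cancel₀ hg0', one_smul]

end Bounds

end Literature.MathematicalPhysics.QuantumFieldTheory.Balaban1983to89.B14.ChangeOfVariables
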